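import Literature.MathematicalPhysics.QuantumFieldTheory.Balaban1983to89.Node00.Record13NumericsOfThm1C
import Literature.MathematicalPhysics.QuantumFieldTheory.Balaban1983to89.Node00.Record13BgRow
import Literature.MathematicalPhysics.QuantumFieldTheory.Balaban1983to89.Node00.Record12BgRowCubeGeometry

/-!
# NODE 00 (YM-PLAN Track A) — STAGE 13: ROW P11 AT THE `L`-KEYED WITNESS `θ₁₅ᶜ = theta13OfThm1C` FROM THE FAITHFUL NAMED FACT `VariationalThm1ScaledSep`
# ([15] Thm 1 (8) for PRINT'S — separated — sequences), the two DERIVATIVE MEMBERS (9)–(10), and the displayed RUN CONDITIONS (comparability of the thresholds,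
# (C2) «the `𝐃_j`-cubes fit in the torus»): node00-def-P11's FILE 5 v1.2 faithful chain lifted to the Stage-13 parameter, every letter inequality IN KERNEL

Cell `pub-ymgap`, seat `pub-ymgap-node00-def-K0a` (g4), FILE 11b (companion of FILE 11a `Node00/Record13NumericsOfThm1C`: the numerics `stage12NumericsOfThm1C L ε₀ B₃ a₀ a₁`,
the witness `theta13OfThm1C F N ε₀ ε₂₉ B₃ a₀ a₁`, and the window ⇒ letter lemmas for BOTH halves of row P11).  director-ym LINE №136 (2) «K0a FILE 10∕11 keys on the
FAITHFUL fact `VariationalThm1ScaledSep`, never on `…Scaled`» (node00-def-P11 LOCATED-P11-SEQ: r11's (2.18) index types nesting only, not print's separation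
`dist(Ω_n, Ωᶜ_{n−1}) ≥ LⁿξM₁` — [6] (1.3)–(1.6) — nor the comparability (2.7)–(2.8) of the thresholds; every `∀ s : SeqOfRecord` row is print-stronger by exactly these).
node00-def-P11's FILE 5 v1.2 `Node00/Record12BgRowCubeGeometry` proves, at def-R's objects and ONE SEPARATED SEQUENCE, ★★★ `bgRowAt_of_thm1ScaledSep`: the two guarded
memberships of the ranged row from (R1′) the FAITHFUL named fact `VariationalThm1ScaledSep B₃ a₀ a₁`, (R2) the two derivative members `h3I` ∕ `h3MS` ([15] Thm 1
(9)–(10) for the axial potentials), the comparability `cR·ε_n ≤ 2·cR·ε_{n+1}` of the thresholds along the history, the arithmetic side conditions (C1) `R_j = L·t_j`,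
(C2) `L^j·M·R_j ∣ 2L^{m+K}`, no wrapping, and the letter inequalities (FILE 2's four + the gauge half's four, chart reachability through the class bounds).  THIS FILE:
§1 lifts it to `θ : Stage13Params` (level `0` vacuous — no scale `1 ≤ j ≤ 0` —, level `n + 1` by `UbgOfRecord₁₃_succ` at `S := settingOfRecord₁₃ F N θ p`); §2 discharges
AT `θ₁₅ᶜ` every letter inequality, (C1) and the no-wrapping clause; §3 assembles.  The conclusion is the BODY of def-R's ranged token `BgProvisoΛ` at the Stage-13
run objects with print's separation `Sect2.SeqSeparated θ.ν.M₁ s` as a DISPLAYED ANTECEDENT on the sequence (№136 (2): «restrict the demand by a displayed antecedent»)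
— the separation-guarded row; composing it with the K0a socket waits for the guarded `Provisos₁₃.bg` of record (№136 (3a)∕(3b), plan's call), a ≤ 20-line successor step.
[I] = [Balaban1987RG1], [III] = [Balaban1988Convergent], [IV] = [Balaban1989LargeFieldI], [6] = [Balaban1985RegularSpaces], [15] = [Balaban1985Variational].

WHAT THIS FILE PROVES (theorems only).
* §1 ★ `Stage13Params.bgSep_of_thm1ScaledSep` — for an admissible `θ` with K0b's residual §2 data: along every run `p`, level `n ≤ K`, windowed history, SEPARATED
  sequence `s`, retained `𝐖`, scale `1 ≤ j ≤ n`, domain `X` — the two guarded memberships (clause I on `X ⊆ Λ_j(s)`, clause MS on the (2.41)(i) range) of the background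
  of record `UbgOfRecord₁₃ F N θ p n s 𝐖` — from (h15′) `VariationalThm1ScaledSep`, `0 ≤ B₃`, `0 < θ.τ9.M`, (ha₀) ∕ (hnum) ∕ (hcomp) ∕ (hBα), (hsN), (hcB) ∕ (hBCM) ∕ (hsmallI) ∕
  (hsmallMS), (hC1) ∕ (hC2), (h3I) ∕ (h3MS) — all DISPLAYED verbatim at `S := settingOfRecord₁₃ F N θ p`, `K := p.K`, `k :=` the level.
* §2 AT `θ₁₅ᶜ`: `hnum_∕hBα_∕hsN_∕hcB_∕hBCM_∕hsmallI_∕hsmallMS_∕hC1_theta13OfThm1C` — every letter inequality of row P11, (C1) and the no-wrapping clause are THEOREMS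
  along every windowed run (`cB = 6L + 1 > 6L`, `B·C·Mr = 7 > 6`, `3·L·η_j·(B₃·ε_j) ≤ 3∕16`, `L^{n} ≤ L^{m+K} < 2L^{m+K}`, `log g_j⁻² > 1`).
* §3 ★★★ `bgSep_theta13OfThm1C_of_thm1ScaledSep (hε hε' hB ha₀ ha₁) (h15 : VariationalThm1ScaledSep F N B₃ a₀ a₁) (hcomp) (hC2) (h3I) (h3MS)` — THE SEPARATION-GUARDED
  ROW P11 AT `θ₁₅ᶜ` ⟸ (R1′) + (R2) + the two displayed RUN conditions (hcomp) «thresholds comparable along the history» ((2.7)–(2.8)) and (C2) «`L^j·M·R_j ∣ 2L^{m+K}`»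
  (p. 257) — NOTHING ELSE.  Both run conditions depend on the history `g` of the run (a non-monotone or very deep history violates them inside the window `]0, ½]`): not
  dischargeable by numerics — DISPLAYED (the plan's call whether to carry them or to restrict the runs).

HONEST FRAMING.  A composition of tree theorems + elementary inequalities and index arithmetic; CONDITIONAL on node00-def-P11's FAITHFUL named fact
`VariationalThm1ScaledSep` ([15] Thm 1 (8) for separated sequences, per-scale reading — a `Prop` hypothesis, NEVER asserted), on the two DISPLAYED derivative members
`h3I` ∕ `h3MS` ([15] Thm 1 (9)–(10) at the axial potentials of def-R's minimiser — hypotheses), and on the two displayed run conditions; nothing of Bałaban asserted;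
NOT a discharge; K0‴ NOT closed by this file (its `Provisos₁₃.bg` of record is the UNGUARDED token — this file supplies the guarded body №136 names); counts unmoved
(typed 28∕28 · discharged 5∕28); one finite 𝕋⁴ programme at fixed ε — NOT continuum ∕ OS ∕ mass gap ∕ Clay.  No `sorry`, no `axiom`, no `def`, no `instance`, no `notation`.
-/

noncomputable section

open MeasureTheory
open scoped Matrix.Norms.L2Operator

namespace Literature.MathematicalPhysics.QuantumFieldTheory.Balaban1983to89.Node00

open T4Continuum B14.Eq218Concrete B15DeterminingSets B12RegularSpaces111 B14RegularSpaces234 B14Radii T4AxialGaugeSmallField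

/-! ## §1. ★ node00-def-P11's FAITHFUL CHAIN (FILE 5 v1.2) LIFTED TO THE STAGE-13 PARAMETER (all hypotheses displayed) -/

section Lift

variable {F : T4Family} {N : ℕ} [NeZero N]

/-- **★ THE SEPARATION-GUARDED ROW P11 AT THE STAGE-13 RECORD from [15] Thm 1 for PRINT'S sequences — (8) as the FAITHFUL named fact `VariationalThm1ScaledSep`, (9)–(10)
as the two DERIVATIVE MEMBERS — the comparability of the thresholds, the compatibility conditions (C1)∕(C2), no wrapping, and the letter inequalities of both halves**
(node00-def-P11's `bgRowAt_of_thm1ScaledSep` lifted to `θ`): for an admissible `θ : Stage13Params F N` with K0b's residual §2 data (`θ.Rz = RzOfRecord F N`), along every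
run, level `n ≤ K` in the window, SEPARATED (2.18) index `s` ([6] (1.3)–(1.6): `Sect2.SeqSeparated θ.ν.M₁ s`), retained `𝐖`, scale `1 ≤ j ≤ n` and domain `X`: the two
guarded memberships of the background of record — the body of def-R's `BgProvisoΛ` at the Stage-13 run objects behind the separation antecedent.  Level `0` is vacuous
(no scale `1 ≤ j ≤ 0`); level `n + 1` is the supplier at `S := settingOfRecord₁₃ F N θ p` (`hι`, `h𝓜` by `rfl`; radii by def-T's `alphaPos₁₃_of_inInterval`) after
`UbgOfRecord₁₃_succ`.  A REDUCTION — nothing of Bałaban asserted.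
[cite: Balaban1985Variational, Thm 1 (8)–(10) p.279; Balaban1985RegularSpaces, (1.3)–(1.8) p.77; Balaban1988Convergent, (2.7)–(2.8) pp.255–256, (2.27)–(2.28) p.259, (2.34)–(2.41) p.261, p.257; Balaban1987RG1, (1.11)–(1.16) p.262] -/
theorem Stage13Params.bgSep_of_thm1ScaledSep (θ : Stage13Params F N) (hθ : θ.Admissible F N) (hRz : θ.Rz = RzOfRecord F N)
    {B₃ a₀ a₁ : ℝ} (h15 : VariationalThm1ScaledSep F N B₃ a₀ a₁) (hB₃ : 0 ≤ B₃) (hM : 0 < θ.τ9.M) (ha₀ : θ.ν.εreg ≤ a₀)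
    (hnum : ∀ (p : B12.RunParams) (n : ℕ), n ≤ p.K → Step.InInterval θ.γ n (gOfRecord₁₃ F N θ p) → ∀ m, m ≤ n →
      0 < θ.s2.cR * epsOfRecord θ.ν (gOfRecord₁₃ F N θ p) m ∧ θ.s2.cR * epsOfRecord θ.ν (gOfRecord₁₃ F N θ p) m ≤ a₁ ∧
        B₃ * (θ.s2.cR * epsOfRecord θ.ν (gOfRecord₁₃ F N θ p) m) ≤ θ.ν.εreg)
    (hcomp : ∀ (p : B12.RunParams) (n : ℕ), n ≤ p.K → Step.InInterval θ.γ n (gOfRecord₁₃ F N θ p) → ∀ m, m < n →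
      θ.s2.cR * epsOfRecord θ.ν (gOfRecord₁₃ F N θ p) m ≤ 2 * (θ.s2.cR * epsOfRecord θ.ν (gOfRecord₁₃ F N θ p) (m + 1)))
    (hBα : ∀ (p : B12.RunParams) (n : ℕ), n ≤ p.K → Step.InInterval θ.γ n (gOfRecord₁₃ F N θ p) → ∀ m, 1 ≤ m → m ≤ n →
      B₃ * (θ.s2.cR * epsOfRecord θ.ν (gOfRecord₁₃ F N θ p) m) ≤ (1 - θ.s2.βc) * (lfOfRecord₁₂ F N θ.toStage12Params).alpha0 (gOfRecord₁₃ F N θ p m))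
    (hsN : ∀ (p : B12.RunParams) (n : ℕ), n ≤ p.K → ∀ n', 1 ≤ n' → n' ≤ n + 1 →
      ((B14.Eq213MaximalDomains.side (F.P p.K).L θ.τ9.M n' : ℕ) : ℤ) < (F.P p.K).sitesPerDir 0)
    (hcB : ∀ p : B12.RunParams, 2 * (((F.P p.K).d - 1 : ℕ) : ℝ) * ((F.P p.K).L * θ.τ9.M) < θ.s2.cB)
    (hBCM : ∀ p : B12.RunParams, 2 * (((F.P p.K).d - 1 : ℕ) : ℝ) * θ.τ9.M < θ.s2.B * θ.s2.C * θ.s2.Mr)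
    (hsmallI : ∀ (p : B12.RunParams) (n : ℕ), n ≤ p.K → Step.InInterval θ.γ n (gOfRecord₁₃ F N θ p) → ∀ j, 1 ≤ j → j ≤ n →
      (((F.P p.K).d - 1 : ℕ) : ℝ) * ((F.P p.K).L * θ.τ9.M) * (F.P p.K).eta j * (B₃ * (θ.s2.cR * epsOfRecord θ.ν (gOfRecord₁₃ F N θ p) j)) ≤ 1 / 2)
    (hsmallMS : ∀ (p : B12.RunParams) (n : ℕ), n ≤ p.K → Step.InInterval θ.γ n (gOfRecord₁₃ F N θ p) → ∀ m, 1 ≤ m → m ≤ n →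
      (((F.P p.K).d - 1 : ℕ) : ℝ) * θ.τ9.M * (F.P p.K).eta m * (B₃ * (θ.s2.cR * epsOfRecord θ.ν (gOfRecord₁₃ F N θ p) m)) ≤ 1 / 2)
    (hC1 : ∀ (p : B12.RunParams) (n : ℕ), n ≤ p.K → Step.InInterval θ.γ n (gOfRecord₁₃ F N θ p) → ∀ j, 1 ≤ j → j ≤ n →
      ∃ t : ℕ, 0 < t ∧ RkOfRecord (F.P p.K).L θ.ν.r (gOfRecord₁₃ F N θ p j) = (F.P p.K).L * t)
    (hC2 : ∀ (p : B12.RunParams) (n : ℕ), n ≤ p.K → Step.InInterval θ.γ n (gOfRecord₁₃ F N θ p) → ∀ j, 1 ≤ j → j ≤ n →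
      dCubeSide (F.P p.K).L θ.τ9.M (RkOfRecord (F.P p.K).L θ.ν.r (gOfRecord₁₃ F N θ p j)) j ∣ (F.P p.K).sitesPerDir 0)
    (h3I : ∀ (p : B12.RunParams) (n : ℕ), n ≤ p.K → Step.InInterval θ.γ n (gOfRecord₁₃ F N θ p) →
      ∀ s : SeqOfRecord F θ.ν θ.τ9.M (gOfRecord₁₃ F N θ p) p.K n, Sect2.SeqSeparated θ.ν.M₁ s → ∀ W : MSField (F.P p.K) (SU N),
      W ∈ suppOfRecord₁₃ F N θ p n s → W ∈ solvableDom (avOfRecord F N p.K) (regMSOfRecord F N θ.ν p.K n s.Ω) (genSet s.Ω n) →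
      ∀ j, 1 ≤ j → j ≤ n → ∀ X : (Sect2.domSys (F.P p.K) θ.τ9.M j).Dom, Sect2.domSites (F.P p.K) θ.τ9.M j X ⊆ s.Λ j →
      ∀ a ∈ cubeIndices (F.P p.K) (B14.Eq213MaximalDomains.side (F.P p.K).L θ.τ9.M (j + 1)),
        (cubeEnl (F.P p.K) (B14.Eq213MaximalDomains.side (F.P p.K).L θ.τ9.M (j + 1)) a 0 ∩ Sect2.domSites (F.P p.K) θ.τ9.M j X).Nonempty →
        ∀ q ∈ (Sect2.regionOfSet (F.P p.K) (cubeEnl (F.P p.K) (B14.Eq213MaximalDomains.side (F.P p.K).L θ.τ9.M (j + 1)) a 0 ∩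
            Sect2.domSites (F.P p.K) θ.τ9.M j X)).dpairs,
          ‖grad ((F.P p.K).eta j) q.2.1 (fun y => axialPotential (UbgMSOfRecord F N θ.ν θ.τ9.M (gOfRecord₁₃ F N θ p) p.K n s W)
            (boxLo (B14.Eq213MaximalDomains.side (F.P p.K).L θ.τ9.M (j + 1)) a) (boxHi (B14.Eq213MaximalDomains.side (F.P p.K).L θ.τ9.M (j + 1)) a) ((F.P p.K).eta j) ⟨y, q.2.2⟩) q.1‖ <
            θ.s2.cB * (lfOfRecord₁₂ F N θ.toStage12Params).alpha0 (gOfRecord₁₃ F N θ p j))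
    (h3MS : ∀ (p : B12.RunParams) (n : ℕ), n ≤ p.K → Step.InInterval θ.γ n (gOfRecord₁₃ F N θ p) →
      ∀ s : SeqOfRecord F θ.ν θ.τ9.M (gOfRecord₁₃ F N θ p) p.K n, Sect2.SeqSeparated θ.ν.M₁ s → ∀ W : MSField (F.P p.K) (SU N),
      W ∈ suppOfRecord₁₃ F N θ p n s → W ∈ solvableDom (avOfRecord F N p.K) (regMSOfRecord F N θ.ν p.K n s.Ω) (genSet s.Ω n) →
      ∀ j, 1 ≤ j → j ≤ n → ∀ X : (Sect2.domSys (F.P p.K) θ.τ9.M j).Dom, ∀ m, 1 ≤ m → m ≤ j →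
      ∀ a ∈ cubeIndices (F.P p.K) (B14.Eq213MaximalDomains.side (F.P p.K).L θ.τ9.M m),
        (cubeEnl (F.P p.K) (B14.Eq213MaximalDomains.side (F.P p.K).L θ.τ9.M m) a 0 ∩ Sect2.domSites (F.P p.K) θ.τ9.M j X).Nonempty →
        cubeEnl (F.P p.K) (B14.Eq213MaximalDomains.side (F.P p.K).L θ.τ9.M m) a 0 ⊆ s.Ω m →
        ∀ q ∈ (Sect2.regionOfSet (F.P p.K) (cubeEnl (F.P p.K) (B14.Eq213MaximalDomains.side (F.P p.K).L θ.τ9.M m) a 0 ∩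
            Sect2.domSites (F.P p.K) θ.τ9.M j X)).dpairs,
          (((F.P p.K).L : ℝ) ^ m * (F.P p.K).eta j) ^ 2 *
            ‖grad ((F.P p.K).eta j) q.2.1 (fun y => axialPotential (UbgMSOfRecord F N θ.ν θ.τ9.M (gOfRecord₁₃ F N θ p) p.K n s W)
              (boxLo (B14.Eq213MaximalDomains.side (F.P p.K).L θ.τ9.M m) a) (boxHi (B14.Eq213MaximalDomains.side (F.P p.K).L θ.τ9.M m) a) ((F.P p.K).eta j) ⟨y, q.2.2⟩) q.1‖ <
            rad238 θ.s2.B θ.s2.C θ.s2.Mr ((lfOfRecord₁₂ F N θ.toStage12Params).alpha0 (gOfRecord₁₃ F N θ p m))) :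
    ∀ (p : B12.RunParams) (n : ℕ), n ≤ p.K → Step.InInterval θ.γ n (gOfRecord₁₃ F N θ p) →
      ∀ s : SeqOfRecord F θ.ν θ.τ9.M (gOfRecord₁₃ F N θ p) p.K n, Sect2.SeqSeparated θ.ν.M₁ s →
      ∀ W : MSField (F.P p.K) (SU N), W ∈ suppOfRecord₁₃ F N θ p n s →
      ∀ j, 1 ≤ j → j ≤ n → ∀ X : (Sect2.domSys (F.P p.K) θ.τ9.M j).Dom,
      (Sect2.domSites (F.P p.K) θ.τ9.M j X ⊆ s.Λ j →
        Sect2.ofBackgroundC (settingOfRecord₁₃ F N θ p).ι (UbgOfRecord₁₃ F N θ p n s W) ∈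
          Sect2.spaceI (settingOfRecord₁₃ F N θ p) (θ.Rz p.K) θ.τ9.M j (Sect2.domSites (F.P p.K) θ.τ9.M j X)
            ((settingOfRecord₁₃ F N θ p).lf.alpha0 ((settingOfRecord₁₃ F N θ p).flow.g j)) ((settingOfRecord₁₃ F N θ p).lf.alpha1 ((settingOfRecord₁₃ F N θ p).flow.g j))) ∧
      (Sect2.admB (F.P p.K) θ.ν θ.τ9.M (gOfRecord₁₃ F N θ p) s.Ω s.Λ j (Sect2.domSites (F.P p.K) θ.τ9.M j X) = true →
        Sect2.ofBackgroundC (settingOfRecord₁₃ F N θ p).ι (UbgOfRecord₁₃ F N θ p n s W) ∈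
          Sect2.spaceMS (settingOfRecord₁₃ F N θ p) (θ.Rz p.K) θ.τ9.M j (Sect2.domSites (F.P p.K) θ.τ9.M j X) s.Ω) := by
  intro p n hn hw
  rw [hRz]
  cases n with
  | zero =>
    intro s _ W _ j h1 hj
    exfalso
    omega
  | succ n =>
    rw [UbgOfRecord₁₃_succ]
    exact fun s hsep W hW j h1 hj X =>
      bgRowAt_of_thm1ScaledSep h15 (settingOfRecord₁₃ F N θ p) rfl rfl (settingOfRecord₁₃_laws F N θ p) (settingOfRecord₁₃_pos F N θ hθ.1.pos p)
        θ.ν hM p.K (n + 1) θ.s2.cR hB₃ (hnum p (n + 1) hn hw) ha₀ (hcomp p (n + 1) hn hw) (fun m _ hm => alphaPos₁₃_of_inInterval hθ hw hm)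
        (hBα p (n + 1) hn hw) (hsN p (n + 1) hn) (hcB p) (hBCM p) (hsmallI p (n + 1) hn hw) (hsmallMS p (n + 1) hn hw) (hC1 p (n + 1) hn hw)
        (hC2 p (n + 1) hn hw) s hsep (h3I p (n + 1) hn hw s hsep) (h3MS p (n + 1) hn hw s hsep) W hW j h1 hj X

end Lift

/-! ## §2. AT THE `L`-KEYED WITNESS `θ₁₅ᶜ`: every letter inequality of row P11, (C1) and the no-wrapping clause are theorems -/

section Letters

variable {F : T4Family} {N : ℕ} [NeZero N] {ε₀ ε₂₉ B₃ a₀ a₁ : ℝ}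

/-- **FILE 2's (hnum) IS A THEOREM AT `θ₁₅ᶜ`** along every windowed run. [cite: Balaban1988Convergent, (2.4) p.255, (2.12) p.256; Balaban1985Variational, Thm 1 (7)–(8) p.279] -/
theorem hnum_theta13OfThm1C (hB : 0 ≤ B₃) (ha₀ : 0 < a₀) (ha₁ : 0 < a₁) :
    ∀ (p : B12.RunParams) (n : ℕ), n ≤ p.K → Step.InInterval (theta13OfThm1C F N ε₀ ε₂₉ B₃ a₀ a₁).γ n (gOfRecord₁₃ F N (theta13OfThm1C F N ε₀ ε₂₉ B₃ a₀ a₁) p) → ∀ m, m ≤ n →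
      0 < (theta13OfThm1C F N ε₀ ε₂₉ B₃ a₀ a₁).s2.cR * epsOfRecord (theta13OfThm1C F N ε₀ ε₂₉ B₃ a₀ a₁).ν (gOfRecord₁₃ F N (theta13OfThm1C F N ε₀ ε₂₉ B₃ a₀ a₁) p) m ∧ (theta13OfThm1C F N ε₀ ε₂₉ B₃ a₀ a₁).s2.cR * epsOfRecord (theta13OfThm1C F N ε₀ ε₂₉ B₃ a₀ a₁).ν (gOfRecord₁₃ F N (theta13OfThm1C F N ε₀ ε₂₉ B₃ a₀ a₁) p) m ≤ a₁ ∧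
        B₃ * ((theta13OfThm1C F N ε₀ ε₂₉ B₃ a₀ a₁).s2.cR * epsOfRecord (theta13OfThm1C F N ε₀ ε₂₉ B₃ a₀ a₁).ν (gOfRecord₁₃ F N (theta13OfThm1C F N ε₀ ε₂₉ B₃ a₀ a₁) p) m) ≤ (theta13OfThm1C F N ε₀ ε₂₉ B₃ a₀ a₁).ν.εreg :=
  fun _ _ _ hw => numerics_thm1C_of_inInterval hB ha₀ ha₁ (by norm_num : (1 / 2 : ℝ) < 1) hw

/-- **FILE 2's (hBα) IS A THEOREM AT `θ₁₅ᶜ`** (`bg_numerics_of_letters`: `p₀ = 1 ≤ q₀ = 2`, `B₃·A₀ᶜ ≤ ¾·C₀`, `g_m² ≤ ¼ ≤ e⁻¹`). [cite: Balaban1988Convergent, (2.4) p.255, (2.28) p.259, (2.34) p.261] -/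
theorem hBα_theta13OfThm1C (hB : 0 ≤ B₃) (ha₀ : 0 ≤ a₀) (ha₁ : 0 ≤ a₁) :
    ∀ (p : B12.RunParams) (n : ℕ), n ≤ p.K → Step.InInterval (theta13OfThm1C F N ε₀ ε₂₉ B₃ a₀ a₁).γ n (gOfRecord₁₃ F N (theta13OfThm1C F N ε₀ ε₂₉ B₃ a₀ a₁) p) → ∀ m, 1 ≤ m → m ≤ n →
      B₃ * ((theta13OfThm1C F N ε₀ ε₂₉ B₃ a₀ a₁).s2.cR * epsOfRecord (theta13OfThm1C F N ε₀ ε₂₉ B₃ a₀ a₁).ν (gOfRecord₁₃ F N (theta13OfThm1C F N ε₀ ε₂₉ B₃ a₀ a₁) p) m) ≤ (1 - (theta13OfThm1C F N ε₀ ε₂₉ B₃ a₀ a₁).s2.βc) * (lfOfRecord₁₂ F N (theta13OfThm1C F N ε₀ ε₂₉ B₃ a₀ a₁).toStage12Params).alpha0 (gOfRecord₁₃ F N (theta13OfThm1C F N ε₀ ε₂₉ B₃ a₀ a₁) p m) :=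
  fun p n _ hw =>
    (theta13OfThm1C F N ε₀ ε₂₉ B₃ a₀ a₁).bg_numerics_of_letters
      (by rw [theta13OfThm1C_p₀, lfOfRecord₁₂_theta13OfThm1C]; norm_num [lfConstsOfFamily, lfConstsOfRecord₁₂])
      (mul_A0_nonneg_thm1C hB ha₀ ha₁) (mul_A0_le_C₀_thm1C hB) p n (window_sq_le_of_inInterval (theta13OfThm1C_γ F N ε₀ ε₂₉ B₃ a₀ a₁).le hw)

/-- **NO WRAPPING AT `θ₁₅ᶜ`**: the cubes of record of side `L^{n'}·M = L^{n'}` (`n' ≤ k + 1 ≤ K + 1 ≤ m + K`) are shorter than the torus (`2L^{m+K}` sites per direction).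
[cite: Balaban1987RG1, (0.1) p.251; Balaban1988Convergent, p.257 (bookkeeping)] -/
theorem hsN_theta13OfThm1C :
    ∀ (p : B12.RunParams) (n : ℕ), n ≤ p.K → ∀ n', 1 ≤ n' → n' ≤ n + 1 →
      ((B14.Eq213MaximalDomains.side (F.P p.K).L (theta13OfThm1C F N ε₀ ε₂₉ B₃ a₀ a₁).τ9.M n' : ℕ) : ℤ) < (F.P p.K).sitesPerDir 0 := by
  intro p n hn n' _ hn'
  rw [theta13OfThm1C_τ9_M]
  have hm := F.hm
  have hL : 0 < F.L := by have := F.hL11; omega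
  have hnat : B14.Eq213MaximalDomains.side (F.P p.K).L 1 n' < (F.P p.K).sitesPerDir 0 := by
    show F.L ^ n' * 1 < 2 * F.L ^ (F.m + p.K - 0)
    rw [mul_one, Nat.sub_zero]
    have h1 : F.L ^ n' ≤ F.L ^ (F.m + p.K) := Nat.pow_le_pow_right hL (by omega)
    have h0 : 0 < F.L ^ (F.m + p.K) := Nat.pow_pos hL
    omega
  exact_mod_cast hnat

/-- **«B sufficiently large» AT `θ₁₅ᶜ`**: `2(d−1)·L·M = 6L < 6L + 1 = O(1)LMB`. [cite: Balaban1987RG1, (1.12) p.262; Balaban1988Convergent, p.256] -/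
theorem hcB_theta13OfThm1C :
    ∀ p : B12.RunParams, 2 * (((F.P p.K).d - 1 : ℕ) : ℝ) * ((F.P p.K).L * (theta13OfThm1C F N ε₀ ε₂₉ B₃ a₀ a₁).τ9.M) < (theta13OfThm1C F N ε₀ ε₂₉ B₃ a₀ a₁).s2.cB := by
  intro p
  rw [theta13OfThm1C_cB, theta13OfThm1C_τ9_M]
  have hd : (F.P p.K).d = 4 := rfl
  have hL : ((F.P p.K).L : ℝ) = F.L := rfl
  simp only [hd, hL]
  push_cast
  linarith

/-- **`BCM > 2(d−1)M` AT `θ₁₅ᶜ`**: `6 < 7`. [cite: Balaban1988Convergent, (2.38) p.261] -/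
theorem hBCM_theta13OfThm1C :
    ∀ p : B12.RunParams, 2 * (((F.P p.K).d - 1 : ℕ) : ℝ) * (theta13OfThm1C F N ε₀ ε₂₉ B₃ a₀ a₁).τ9.M < (theta13OfThm1C F N ε₀ ε₂₉ B₃ a₀ a₁).s2.B * (theta13OfThm1C F N ε₀ ε₂₉ B₃ a₀ a₁).s2.C * (theta13OfThm1C F N ε₀ ε₂₉ B₃ a₀ a₁).s2.Mr := by
  intro p
  rw [theta13OfThm1C_B, theta13OfThm1C_C, theta13OfThm1C_Mr, theta13OfThm1C_τ9_M]
  have hd : (F.P p.K).d = 4 := rfl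
  simp only [hd]
  push_cast
  norm_num

/-- **CHART REACHABILITY ON THE `O(1)LM`-CUBES AT `θ₁₅ᶜ`**: `(d−1)·L·M·η_j·(B₃·cR·ε_j) ≤ 3·1·(1∕16) ≤ ½` (`L·η_j ≤ 1` for `j ≥ 1`).
[cite: Balaban1987RG1, (1.12) p.262; Balaban1988Convergent, (2.4) p.255, p.256] -/
theorem hsmallI_theta13OfThm1C (hB : 0 ≤ B₃) (ha₀ : 0 < a₀) (ha₁ : 0 < a₁) :
    ∀ (p : B12.RunParams) (n : ℕ), n ≤ p.K → Step.InInterval (theta13OfThm1C F N ε₀ ε₂₉ B₃ a₀ a₁).γ n (gOfRecord₁₃ F N (theta13OfThm1C F N ε₀ ε₂₉ B₃ a₀ a₁) p) → ∀ j, 1 ≤ j → j ≤ n →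
      (((F.P p.K).d - 1 : ℕ) : ℝ) * ((F.P p.K).L * (theta13OfThm1C F N ε₀ ε₂₉ B₃ a₀ a₁).τ9.M) * (F.P p.K).eta j * (B₃ * ((theta13OfThm1C F N ε₀ ε₂₉ B₃ a₀ a₁).s2.cR * epsOfRecord (theta13OfThm1C F N ε₀ ε₂₉ B₃ a₀ a₁).ν (gOfRecord₁₃ F N (theta13OfThm1C F N ε₀ ε₂₉ B₃ a₀ a₁) p) j)) ≤ 1 / 2 := by
  intro p n _ hw j h1 hj
  set b := B₃ * ((theta13OfThm1C F N ε₀ ε₂₉ B₃ a₀ a₁).s2.cR *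
    epsOfRecord (theta13OfThm1C F N ε₀ ε₂₉ B₃ a₀ a₁).ν (gOfRecord₁₃ F N (theta13OfThm1C F N ε₀ ε₂₉ B₃ a₀ a₁) p) j) with hb_def
  have hb : b ≤ 1 / 16 := mul_epsOfRecord_thm1C_le hB ha₀ ha₁ hw hj
  have hb0 : 0 ≤ b := mul_nonneg hB (hnum_theta13OfThm1C hB ha₀ ha₁ p n ‹_› hw j hj).1.le
  have hLη : ((F.P p.K).L : ℝ) * (F.P p.K).eta j ≤ 1 := cast_mul_eta_le_one (F.P p.K) h1
  have key : ((F.P p.K).L : ℝ) * (F.P p.K).eta j * b ≤ 1 * (1 / 16) := mul_le_mul hLη hb hb0 zero_le_one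
  rw [theta13OfThm1C_τ9_M]
  have hd : (F.P p.K).d = 4 := rfl
  simp only [hd]
  push_cast
  calc (3 : ℝ) * (((F.P p.K).L : ℝ) * 1) * (F.P p.K).eta j * b = 3 * (((F.P p.K).L : ℝ) * (F.P p.K).eta j * b) := by ring
    _ ≤ 3 * (1 * (1 / 16)) := mul_le_mul_of_nonneg_left key (by norm_num)
    _ ≤ 1 / 2 := by norm_num

/-- **CHART REACHABILITY ON THE LAYER CUBES AT `θ₁₅ᶜ`**: `(d−1)·M·η_m·(B₃·cR·ε_m) ≤ 3·1·(1∕16) ≤ ½` (`η_m ≤ 1`). [cite: Balaban1988Convergent, (2.38) p.261, (2.4) p.255] -/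
theorem hsmallMS_theta13OfThm1C (hB : 0 ≤ B₃) (ha₀ : 0 < a₀) (ha₁ : 0 < a₁) :
    ∀ (p : B12.RunParams) (n : ℕ), n ≤ p.K → Step.InInterval (theta13OfThm1C F N ε₀ ε₂₉ B₃ a₀ a₁).γ n (gOfRecord₁₃ F N (theta13OfThm1C F N ε₀ ε₂₉ B₃ a₀ a₁) p) → ∀ m, 1 ≤ m → m ≤ n →
      (((F.P p.K).d - 1 : ℕ) : ℝ) * (theta13OfThm1C F N ε₀ ε₂₉ B₃ a₀ a₁).τ9.M * (F.P p.K).eta m * (B₃ * ((theta13OfThm1C F N ε₀ ε₂₉ B₃ a₀ a₁).s2.cR * epsOfRecord (theta13OfThm1C F N ε₀ ε₂₉ B₃ a₀ a₁).ν (gOfRecord₁₃ F N (theta13OfThm1C F N ε₀ ε₂₉ B₃ a₀ a₁) p) m)) ≤ 1 / 2 := by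
  intro p n _ hw m _ hm
  set b := B₃ * ((theta13OfThm1C F N ε₀ ε₂₉ B₃ a₀ a₁).s2.cR *
    epsOfRecord (theta13OfThm1C F N ε₀ ε₂₉ B₃ a₀ a₁).ν (gOfRecord₁₃ F N (theta13OfThm1C F N ε₀ ε₂₉ B₃ a₀ a₁) p) m) with hb_def
  have hb : b ≤ 1 / 16 := mul_epsOfRecord_thm1C_le hB ha₀ ha₁ hw hm
  have hb0 : 0 ≤ b := mul_nonneg hB (hnum_theta13OfThm1C hB ha₀ ha₁ p n ‹_› hw m hm).1.le
  have hη : (F.P p.K).eta m ≤ 1 := by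
    have hL1 : (1 : ℝ) ≤ (F.P p.K).L := by exact_mod_cast (F.P p.K).L_pos
    exact pow_le_one₀ (inv_nonneg.mpr (by linarith)) (inv_le_one_of_one_le₀ hL1)
  have key : (F.P p.K).eta m * b ≤ 1 * (1 / 16) := mul_le_mul hη hb hb0 zero_le_one
  rw [theta13OfThm1C_τ9_M]
  have hd : (F.P p.K).d = 4 := rfl
  simp only [hd]
  push_cast
  calc (3 : ℝ) * 1 * (F.P p.K).eta m * b = 3 * ((F.P p.K).eta m * b) := by ring
    _ ≤ 3 * (1 * (1 / 16)) := mul_le_mul_of_nonneg_left key (by norm_num)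
    _ ≤ 1 / 2 := by norm_num

/-- **(C1) NESTED GRIDS AT `θ₁₅ᶜ`**: `R_j = L·t_j` along every windowed run (node00-def-P11's `exists_RkOfRecord_eq_mul`: `L ≥ 2`, `r = 1`, `log g_j⁻² > 1` in `]0, ½]`).
[cite: Balaban1988Convergent, (2.5) p.255, p.257] -/
theorem hC1_theta13OfThm1C :
    ∀ (p : B12.RunParams) (n : ℕ), n ≤ p.K → Step.InInterval (theta13OfThm1C F N ε₀ ε₂₉ B₃ a₀ a₁).γ n (gOfRecord₁₃ F N (theta13OfThm1C F N ε₀ ε₂₉ B₃ a₀ a₁) p) → ∀ j, 1 ≤ j → j ≤ n →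
      ∃ t : ℕ, 0 < t ∧ RkOfRecord (F.P p.K).L (theta13OfThm1C F N ε₀ ε₂₉ B₃ a₀ a₁).ν.r (gOfRecord₁₃ F N (theta13OfThm1C F N ε₀ ε₂₉ B₃ a₀ a₁) p j) = (F.P p.K).L * t := by
  intro p n _ hw j _ hj
  have hL : 2 ≤ (F.P p.K).L := by show 2 ≤ F.L; have := F.hL11; omega
  exact exists_RkOfRecord_eq_mul hL (le_of_eq (theta13OfThm1C_r F N ε₀ ε₂₉ B₃ a₀ a₁).symm)
    (one_lt_log_inv_sq_of_le_half (hw j hj).1 ((hw j hj).2.trans (theta13OfThm1C_γ F N ε₀ ε₂₉ B₃ a₀ a₁).le))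

end Letters

/-! ## §3. ★★★ THE SEPARATION-GUARDED ROW P11 AT `θ₁₅ᶜ` from (R1′) + (R2) + the two displayed run conditions -/

section Closure

variable {F : T4Family} {N : ℕ} [NeZero N] {ε₀ ε₂₉ B₃ a₀ a₁ : ℝ}

/-- **★★★ THE SEPARATION-GUARDED ROW P11 AT THE `L`-KEYED WITNESS `θ₁₅ᶜ = theta13OfThm1C F N ε₀ ε₂₉ B₃ a₀ a₁`** — along every run, level in the window, SEPARATED sequence,
retained `𝐖`, scale and domain: the two guarded memberships of the background of record — FROM (R1′) the FAITHFUL named fact `VariationalThm1ScaledSep F N B₃ a₀ a₁`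
([15] Thm 1 (8) for print's sequences), (R2) the two displayed derivative members `h3I` ∕ `h3MS` ([15] Thm 1 (9)–(10) for the axial potentials), and the two displayed RUN
conditions (hcomp) «`cR·ε_m ≤ 2·cR·ε_{m+1}` along the history» ((2.7)–(2.8)) and (hC2) «`L^j·M·R_j ∣ 2L^{m+K}`» (p. 257) — under the signs `0 < ε₀`, `0 < ε₂₉`, `0 ≤ B₃`,
`0 < a₀`, `0 < a₁`; every letter inequality, (C1) and the no-wrapping clause discharged by §2.  CONDITIONAL; nothing of Bałaban asserted; K0‴ NOT closed here (its
`Provisos₁₃.bg` of record is the UNGUARDED token).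
[cite: Balaban1985Variational, Thm 1 (8)–(10) p.279; Balaban1985RegularSpaces, (1.3)–(1.8) p.77; Balaban1988Convergent, (2.7)–(2.8) pp.255–256, (2.27)–(2.28) p.259, (2.34)–(2.41) p.261, p.257; Balaban1987RG1, (1.11)–(1.16) p.262; Balaban1989LargeFieldI, (0.3)–(0.4) p.176] -/
theorem bgSep_theta13OfThm1C_of_thm1ScaledSep (hε : 0 < ε₀) (hε' : 0 < ε₂₉) (hB : 0 ≤ B₃) (ha₀ : 0 < a₀) (ha₁ : 0 < a₁)
    (h15 : VariationalThm1ScaledSep F N B₃ a₀ a₁)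
    (hcomp : ∀ (p : B12.RunParams) (n : ℕ), n ≤ p.K → Step.InInterval (theta13OfThm1C F N ε₀ ε₂₉ B₃ a₀ a₁).γ n (gOfRecord₁₃ F N (theta13OfThm1C F N ε₀ ε₂₉ B₃ a₀ a₁) p) → ∀ m, m < n →
      (theta13OfThm1C F N ε₀ ε₂₉ B₃ a₀ a₁).s2.cR * epsOfRecord (theta13OfThm1C F N ε₀ ε₂₉ B₃ a₀ a₁).ν (gOfRecord₁₃ F N (theta13OfThm1C F N ε₀ ε₂₉ B₃ a₀ a₁) p) m ≤ 2 * ((theta13OfThm1C F N ε₀ ε₂₉ B₃ a₀ a₁).s2.cR * epsOfRecord (theta13OfThm1C F N ε₀ ε₂₉ B₃ a₀ a₁).ν (gOfRecord₁₃ F N (theta13OfThm1C F N ε₀ ε₂₉ B₃ a₀ a₁) p) (m + 1)))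
    (hC2 : ∀ (p : B12.RunParams) (n : ℕ), n ≤ p.K → Step.InInterval (theta13OfThm1C F N ε₀ ε₂₉ B₃ a₀ a₁).γ n (gOfRecord₁₃ F N (theta13OfThm1C F N ε₀ ε₂₉ B₃ a₀ a₁) p) → ∀ j, 1 ≤ j → j ≤ n →
      dCubeSide (F.P p.K).L (theta13OfThm1C F N ε₀ ε₂₉ B₃ a₀ a₁).τ9.M (RkOfRecord (F.P p.K).L (theta13OfThm1C F N ε₀ ε₂₉ B₃ a₀ a₁).ν.r (gOfRecord₁₃ F N (theta13OfThm1C F N ε₀ ε₂₉ B₃ a₀ a₁) p j)) j ∣ (F.P p.K).sitesPerDir 0)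
    (h3I : ∀ (p : B12.RunParams) (n : ℕ), n ≤ p.K → Step.InInterval (theta13OfThm1C F N ε₀ ε₂₉ B₃ a₀ a₁).γ n (gOfRecord₁₃ F N (theta13OfThm1C F N ε₀ ε₂₉ B₃ a₀ a₁) p) →
      ∀ s : SeqOfRecord F (theta13OfThm1C F N ε₀ ε₂₉ B₃ a₀ a₁).ν (theta13OfThm1C F N ε₀ ε₂₉ B₃ a₀ a₁).τ9.M (gOfRecord₁₃ F N (theta13OfThm1C F N ε₀ ε₂₉ B₃ a₀ a₁) p) p.K n, Sect2.SeqSeparated (theta13OfThm1C F N ε₀ ε₂₉ B₃ a₀ a₁).ν.M₁ s → ∀ W : MSField (F.P p.K) (SU N),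
      W ∈ suppOfRecord₁₃ F N (theta13OfThm1C F N ε₀ ε₂₉ B₃ a₀ a₁) p n s → W ∈ solvableDom (avOfRecord F N p.K) (regMSOfRecord F N (theta13OfThm1C F N ε₀ ε₂₉ B₃ a₀ a₁).ν p.K n s.Ω) (genSet s.Ω n) →
      ∀ j, 1 ≤ j → j ≤ n → ∀ X : (Sect2.domSys (F.P p.K) (theta13OfThm1C F N ε₀ ε₂₉ B₃ a₀ a₁).τ9.M j).Dom, Sect2.domSites (F.P p.K) (theta13OfThm1C F N ε₀ ε₂₉ B₃ a₀ a₁).τ9.M j X ⊆ s.Λ j →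
      ∀ a ∈ cubeIndices (F.P p.K) (B14.Eq213MaximalDomains.side (F.P p.K).L (theta13OfThm1C F N ε₀ ε₂₉ B₃ a₀ a₁).τ9.M (j + 1)),
        (cubeEnl (F.P p.K) (B14.Eq213MaximalDomains.side (F.P p.K).L (theta13OfThm1C F N ε₀ ε₂₉ B₃ a₀ a₁).τ9.M (j + 1)) a 0 ∩ Sect2.domSites (F.P p.K) (theta13OfThm1C F N ε₀ ε₂₉ B₃ a₀ a₁).τ9.M j X).Nonempty →
        ∀ q ∈ (Sect2.regionOfSet (F.P p.K) (cubeEnl (F.P p.K) (B14.Eq213MaximalDomains.side (F.P p.K).L (theta13OfThm1C F N ε₀ ε₂₉ B₃ a₀ a₁).τ9.M (j + 1)) a 0 ∩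
            Sect2.domSites (F.P p.K) (theta13OfThm1C F N ε₀ ε₂₉ B₃ a₀ a₁).τ9.M j X)).dpairs,
          ‖grad ((F.P p.K).eta j) q.2.1 (fun y => axialPotential (UbgMSOfRecord F N (theta13OfThm1C F N ε₀ ε₂₉ B₃ a₀ a₁).ν (theta13OfThm1C F N ε₀ ε₂₉ B₃ a₀ a₁).τ9.M (gOfRecord₁₃ F N (theta13OfThm1C F N ε₀ ε₂₉ B₃ a₀ a₁) p) p.K n s W)
            (boxLo (B14.Eq213MaximalDomains.side (F.P p.K).L (theta13OfThm1C F N ε₀ ε₂₉ B₃ a₀ a₁).τ9.M (j + 1)) a) (boxHi (B14.Eq213MaximalDomains.side (F.P p.K).L (theta13OfThm1C F N ε₀ ε₂₉ B₃ a₀ a₁).τ9.M (j + 1)) a) ((F.P p.K).eta j) ⟨y, q.2.2⟩) q.1‖ <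
            (theta13OfThm1C F N ε₀ ε₂₉ B₃ a₀ a₁).s2.cB * (lfOfRecord₁₂ F N (theta13OfThm1C F N ε₀ ε₂₉ B₃ a₀ a₁).toStage12Params).alpha0 (gOfRecord₁₃ F N (theta13OfThm1C F N ε₀ ε₂₉ B₃ a₀ a₁) p j))
    (h3MS : ∀ (p : B12.RunParams) (n : ℕ), n ≤ p.K → Step.InInterval (theta13OfThm1C F N ε₀ ε₂₉ B₃ a₀ a₁).γ n (gOfRecord₁₃ F N (theta13OfThm1C F N ε₀ ε₂₉ B₃ a₀ a₁) p) →
      ∀ s : SeqOfRecord F (theta13OfThm1C F N ε₀ ε₂₉ B₃ a₀ a₁).ν (theta13OfThm1C F N ε₀ ε₂₉ B₃ a₀ a₁).τ9.M (gOfRecord₁₃ F N (theta13OfThm1C F N ε₀ ε₂₉ B₃ a₀ a₁) p) p.K n, Sect2.SeqSeparated (theta13OfThm1C F N ε₀ ε₂₉ B₃ a₀ a₁).ν.M₁ s → ∀ W : MSField (F.P p.K) (SU N),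
      W ∈ suppOfRecord₁₃ F N (theta13OfThm1C F N ε₀ ε₂₉ B₃ a₀ a₁) p n s → W ∈ solvableDom (avOfRecord F N p.K) (regMSOfRecord F N (theta13OfThm1C F N ε₀ ε₂₉ B₃ a₀ a₁).ν p.K n s.Ω) (genSet s.Ω n) →
      ∀ j, 1 ≤ j → j ≤ n → ∀ X : (Sect2.domSys (F.P p.K) (theta13OfThm1C F N ε₀ ε₂₉ B₃ a₀ a₁).τ9.M j).Dom, ∀ m, 1 ≤ m → m ≤ j →
      ∀ a ∈ cubeIndices (F.P p.K) (B14.Eq213MaximalDomains.side (F.P p.K).L (theta13OfThm1C F N ε₀ ε₂₉ B₃ a₀ a₁).τ9.M m),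
        (cubeEnl (F.P p.K) (B14.Eq213MaximalDomains.side (F.P p.K).L (theta13OfThm1C F N ε₀ ε₂₉ B₃ a₀ a₁).τ9.M m) a 0 ∩ Sect2.domSites (F.P p.K) (theta13OfThm1C F N ε₀ ε₂₉ B₃ a₀ a₁).τ9.M j X).Nonempty →
        cubeEnl (F.P p.K) (B14.Eq213MaximalDomains.side (F.P p.K).L (theta13OfThm1C F N ε₀ ε₂₉ B₃ a₀ a₁).τ9.M m) a 0 ⊆ s.Ω m →
        ∀ q ∈ (Sect2.regionOfSet (F.P p.K) (cubeEnl (F.P p.K) (B14.Eq213MaximalDomains.side (F.P p.K).L (theta13OfThm1C F N ε₀ ε₂₉ B₃ a₀ a₁).τ9.M m) a 0 ∩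
            Sect2.domSites (F.P p.K) (theta13OfThm1C F N ε₀ ε₂₉ B₃ a₀ a₁).τ9.M j X)).dpairs,
          (((F.P p.K).L : ℝ) ^ m * (F.P p.K).eta j) ^ 2 *
            ‖grad ((F.P p.K).eta j) q.2.1 (fun y => axialPotential (UbgMSOfRecord F N (theta13OfThm1C F N ε₀ ε₂₉ B₃ a₀ a₁).ν (theta13OfThm1C F N ε₀ ε₂₉ B₃ a₀ a₁).τ9.M (gOfRecord₁₃ F N (theta13OfThm1C F N ε₀ ε₂₉ B₃ a₀ a₁) p) p.K n s W)
              (boxLo (B14.Eq213MaximalDomains.side (F.P p.K).L (theta13OfThm1C F N ε₀ ε₂₉ B₃ a₀ a₁).τ9.M m) a) (boxHi (B14.Eq213MaximalDomains.side (F.P p.K).L (theta13OfThm1C F N ε₀ ε₂₉ B₃ a₀ a₁).τ9.M m) a) ((F.P p.K).eta j) ⟨y, q.2.2⟩) q.1‖ <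
            rad238 (theta13OfThm1C F N ε₀ ε₂₉ B₃ a₀ a₁).s2.B (theta13OfThm1C F N ε₀ ε₂₉ B₃ a₀ a₁).s2.C (theta13OfThm1C F N ε₀ ε₂₉ B₃ a₀ a₁).s2.Mr ((lfOfRecord₁₂ F N (theta13OfThm1C F N ε₀ ε₂₉ B₃ a₀ a₁).toStage12Params).alpha0 (gOfRecord₁₃ F N (theta13OfThm1C F N ε₀ ε₂₉ B₃ a₀ a₁) p m))) :
    ∀ (p : B12.RunParams) (n : ℕ), n ≤ p.K → Step.InInterval (theta13OfThm1C F N ε₀ ε₂₉ B₃ a₀ a₁).γ n (gOfRecord₁₃ F N (theta13OfThm1C F N ε₀ ε₂₉ B₃ a₀ a₁) p) →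
      ∀ s : SeqOfRecord F (theta13OfThm1C F N ε₀ ε₂₉ B₃ a₀ a₁).ν (theta13OfThm1C F N ε₀ ε₂₉ B₃ a₀ a₁).τ9.M (gOfRecord₁₃ F N (theta13OfThm1C F N ε₀ ε₂₉ B₃ a₀ a₁) p) p.K n, Sect2.SeqSeparated (theta13OfThm1C F N ε₀ ε₂₉ B₃ a₀ a₁).ν.M₁ s →
      ∀ W : MSField (F.P p.K) (SU N), W ∈ suppOfRecord₁₃ F N (theta13OfThm1C F N ε₀ ε₂₉ B₃ a₀ a₁) p n s →
      ∀ j, 1 ≤ j → j ≤ n → ∀ X : (Sect2.domSys (F.P p.K) (theta13OfThm1C F N ε₀ ε₂₉ B₃ a₀ a₁).τ9.M j).Dom,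
      (Sect2.domSites (F.P p.K) (theta13OfThm1C F N ε₀ ε₂₉ B₃ a₀ a₁).τ9.M j X ⊆ s.Λ j →
        Sect2.ofBackgroundC (settingOfRecord₁₃ F N (theta13OfThm1C F N ε₀ ε₂₉ B₃ a₀ a₁) p).ι (UbgOfRecord₁₃ F N (theta13OfThm1C F N ε₀ ε₂₉ B₃ a₀ a₁) p n s W) ∈
          Sect2.spaceI (settingOfRecord₁₃ F N (theta13OfThm1C F N ε₀ ε₂₉ B₃ a₀ a₁) p) ((theta13OfThm1C F N ε₀ ε₂₉ B₃ a₀ a₁).Rz p.K) (theta13OfThm1C F N ε₀ ε₂₉ B₃ a₀ a₁).τ9.M j (Sect2.domSites (F.P p.K) (theta13OfThm1C F N ε₀ ε₂₉ B₃ a₀ a₁).τ9.M j X)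
            ((settingOfRecord₁₃ F N (theta13OfThm1C F N ε₀ ε₂₉ B₃ a₀ a₁) p).lf.alpha0 ((settingOfRecord₁₃ F N (theta13OfThm1C F N ε₀ ε₂₉ B₃ a₀ a₁) p).flow.g j)) ((settingOfRecord₁₃ F N (theta13OfThm1C F N ε₀ ε₂₉ B₃ a₀ a₁) p).lf.alpha1 ((settingOfRecord₁₃ F N (theta13OfThm1C F N ε₀ ε₂₉ B₃ a₀ a₁) p).flow.g j))) ∧
      (Sect2.admB (F.P p.K) (theta13OfThm1C F N ε₀ ε₂₉ B₃ a₀ a₁).ν (theta13OfThm1C F N ε₀ ε₂₉ B₃ a₀ a₁).τ9.M (gOfRecord₁₃ F N (theta13OfThm1C F N ε₀ ε₂₉ B₃ a₀ a₁) p) s.Ω s.Λ j (Sect2.domSites (F.P p.K) (theta13OfThm1C F N ε₀ ε₂₉ B₃ a₀ a₁).τ9.M j X) = true →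
        Sect2.ofBackgroundC (settingOfRecord₁₃ F N (theta13OfThm1C F N ε₀ ε₂₉ B₃ a₀ a₁) p).ι (UbgOfRecord₁₃ F N (theta13OfThm1C F N ε₀ ε₂₉ B₃ a₀ a₁) p n s W) ∈
          Sect2.spaceMS (settingOfRecord₁₃ F N (theta13OfThm1C F N ε₀ ε₂₉ B₃ a₀ a₁) p) ((theta13OfThm1C F N ε₀ ε₂₉ B₃ a₀ a₁).Rz p.K) (theta13OfThm1C F N ε₀ ε₂₉ B₃ a₀ a₁).τ9.M j (Sect2.domSites (F.P p.K) (theta13OfThm1C F N ε₀ ε₂₉ B₃ a₀ a₁).τ9.M j X) s.Ω) :=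
  (theta13OfThm1C F N ε₀ ε₂₉ B₃ a₀ a₁).bgSep_of_thm1ScaledSep (admissible_theta13OfThm1C F N hε hε' hB ha₀ ha₁) rfl h15 hB
    (by rw [theta13OfThm1C_τ9_M]; exact Nat.one_pos) (theta13OfThm1C_εreg F N ε₀ ε₂₉ B₃ a₀ a₁).le
    (hnum_theta13OfThm1C hB ha₀ ha₁) hcomp (hBα_theta13OfThm1C hB ha₀.le ha₁.le) hsN_theta13OfThm1C hcB_theta13OfThm1C hBCM_theta13OfThm1C
    (hsmallI_theta13OfThm1C hB ha₀ ha₁) (hsmallMS_theta13OfThm1C hB ha₀ ha₁) hC1_theta13OfThm1C hC2 h3I h3MS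

end Closure

end Literature.MathematicalPhysics.QuantumFieldTheory.Balaban1983to89.Node00

end
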